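import Literature.AlgebraicGeometry.ComplexMultiplication.CyclotomicFermatCMTypesKoblitzEllipticLevels
import HarnessLib

/-!
# Koblitz's list of elliptic Fermat levels (Bauer–Coste–Itzykson–Ruelle §3.4 [kob]): the kernel census extended from `n₀ ≤ 30` to `n₀ ≤ 40` —
# no primitive triple with `H_{r,s,t}` a group at `31, 32, 33, 34, 35, 36, 37, 38`; witnesses at `39, 40`

Layer `Literature/AlgebraicGeometry/ComplexMultiplication`; sequel of `CyclotomicFermatCMTypesKoblitzEllipticLevels` (this lane gen 42: witnesses at all
eighteen listed levels; the exhaustive census «a primitive normalised triple with `H` a group exists iff `n ∈ {3,4,6,7,8,12,15,16,18,20,21,22,24,30}`»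
for `3 ≤ n ≤ 30`; honest column (a): «the kernel census stops at `n₀ = 30` (cost ∝ n³)»).  THIS FILE pushes the census to `n₀ ≤ 40`, one level per
declaration (`decide +kernel`, ≈ 20–35 s each), and restates the iff for `3 ≤ n ≤ 40` with the list `{…, 30, 39, 40}`.  THEOREMS ONLY (no definition,
no named fact, no `sorry`).

THE SOURCE.  M. Bauer, A. Coste, C. Itzykson, P. Ruelle, J. Geom. Phys. **22** (1997), §3.4 p. 14 (held `paper:arxiv-hep-th_9604104`): «no `L_{r,s,t}` is
isogenous to a product of elliptic factors unless `n₀` belongs to the following set `{3, 4, 6, 7, 8, 12, 15, 16, 18, 20, 21, 22, 24, 30, 39, 40, 48, 60}`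
[kob]» ([kob] = Koblitz 1978, Duke Math. J. 45, NOT held; acq-13294).

READING.  As in the prequel: normalised representative `(r, s, −r−s)`, `r, s ≠ 0`, `⟨r⟩ + ⟨s⟩ < n` (so `1 ∈ H`), primitive iff `gcd(r, s, n) = 1`;
«splits into elliptic curves» ⟺ `H` closed under multiplication (sibling `exists_isIsogeny_pow_elliptic_fermat_iff_forall_mul_mem`).

## What is proved

* §1 `not_exists_primitive_group_triple_thirtyOne … _thirtyEight` — at each of the levels `31, …, 38` NO primitive normalised triple has `H` a group
  (kernel, exhaustive over `(r, s) ∈ (ℤ/n)²`).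
* §2 **`exists_primitive_group_triple_iff_of_le_forty`** — for `3 ≤ n ≤ 40`: such a triple exists iff `n ∈ {3,4,6,7,8,12,15,16,18,20,21,22,24,30,39,40}`
  (= Koblitz's list `∩ [3, 40]`); **`mem_koblitzList_of_exists_isIsogeny_pow_elliptic_of_le_forty`** (on abelian varieties: for `3 ≤ n ≤ 40`, a primitive
  normalised K–R type at level `n` some realisation of which is isogenous to a power of an elliptic curve forces `n` into the list).

## Honest column

Koblitz's theorem for `n₀ > 40` outside the list remains CITE [kob] (numerics to `72` agree); levels `41–47`, `49–59`, `61–…` are not in the kernel.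
The Hodge conjecture is not proved and nothing here bears on it.
-/

noncomputable section

open NumberField

namespace Literature.AlgebraicGeometry.ComplexMultiplication

open CategoryTheory CategoryTheory.Limits
open Literature.AlgebraicGeometry.Motives (CMType AbelianVariety)
open Literature.AlgebraicGeometry.Motives.AbelianVariety
open Literature.NumberTheory.ComplexMultiplication
open Literature.AlgebraicGeometry.HodgeTheory
open Literature.AlgebraicGeometry.Pohlmann1968 Literature.AlgebraicGeometry.Pohlmann1968.Cyclotomic
open CyclotomicCMTypeResidueSets (IsCMResidueSet unitResidues residueSet residueSet_cmTypeOfResidues isCMResidueSet_residueSet)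

namespace CyclotomicFermatCMType

/-! ## §1 The levels `31, …, 38`: no primitive triple with `H` a group -/

section Levels

set_option maxHeartbeats 1000000 in
/-- **Level `31`**: NO primitive normalised triple `(r, s, −r−s)` modulo `31` has `H_{r,s,t}` closed under multiplication (kernel, all `(r, s)`).
[cite: BauerCosteItzyksonRuelle1997, §3.4] -/
theorem not_exists_primitive_group_triple_thirtyOne :
    ¬∃ r s : ZMod 31, r ≠ 0 ∧ s ≠ 0 ∧ r.val + s.val < 31 ∧ Nat.gcd (Nat.gcd r.val s.val) 31 = 1 ∧
      ∀ a ∈ fermatCMType 31 r s (-(r + s)), ∀ b ∈ fermatCMType 31 r s (-(r + s)), a * b ∈ fermatCMType 31 r s (-(r + s)) := by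
  decide +kernel

set_option maxHeartbeats 1000000 in
/-- **Level `32`**: NO primitive normalised triple `(r, s, −r−s)` modulo `32` has `H_{r,s,t}` closed under multiplication (kernel, all `(r, s)`).
[cite: BauerCosteItzyksonRuelle1997, §3.4] -/
theorem not_exists_primitive_group_triple_thirtyTwo :
    ¬∃ r s : ZMod 32, r ≠ 0 ∧ s ≠ 0 ∧ r.val + s.val < 32 ∧ Nat.gcd (Nat.gcd r.val s.val) 32 = 1 ∧
      ∀ a ∈ fermatCMType 32 r s (-(r + s)), ∀ b ∈ fermatCMType 32 r s (-(r + s)), a * b ∈ fermatCMType 32 r s (-(r + s)) := by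
  decide +kernel

set_option maxHeartbeats 1000000 in
/-- **Level `33`**: NO primitive normalised triple `(r, s, −r−s)` modulo `33` has `H_{r,s,t}` closed under multiplication (kernel, all `(r, s)`).
[cite: BauerCosteItzyksonRuelle1997, §3.4] -/
theorem not_exists_primitive_group_triple_thirtyThree :
    ¬∃ r s : ZMod 33, r ≠ 0 ∧ s ≠ 0 ∧ r.val + s.val < 33 ∧ Nat.gcd (Nat.gcd r.val s.val) 33 = 1 ∧
      ∀ a ∈ fermatCMType 33 r s (-(r + s)), ∀ b ∈ fermatCMType 33 r s (-(r + s)), a * b ∈ fermatCMType 33 r s (-(r + s)) := by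
  decide +kernel

set_option maxHeartbeats 1000000 in
/-- **Level `34`**: NO primitive normalised triple `(r, s, −r−s)` modulo `34` has `H_{r,s,t}` closed under multiplication (kernel, all `(r, s)`).
[cite: BauerCosteItzyksonRuelle1997, §3.4] -/
theorem not_exists_primitive_group_triple_thirtyFour :
    ¬∃ r s : ZMod 34, r ≠ 0 ∧ s ≠ 0 ∧ r.val + s.val < 34 ∧ Nat.gcd (Nat.gcd r.val s.val) 34 = 1 ∧
      ∀ a ∈ fermatCMType 34 r s (-(r + s)), ∀ b ∈ fermatCMType 34 r s (-(r + s)), a * b ∈ fermatCMType 34 r s (-(r + s)) := by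
  decide +kernel

set_option maxHeartbeats 1000000 in
/-- **Level `35`**: NO primitive normalised triple `(r, s, −r−s)` modulo `35` has `H_{r,s,t}` closed under multiplication (kernel, all `(r, s)`).
[cite: BauerCosteItzyksonRuelle1997, §3.4] -/
theorem not_exists_primitive_group_triple_thirtyFive :
    ¬∃ r s : ZMod 35, r ≠ 0 ∧ s ≠ 0 ∧ r.val + s.val < 35 ∧ Nat.gcd (Nat.gcd r.val s.val) 35 = 1 ∧
      ∀ a ∈ fermatCMType 35 r s (-(r + s)), ∀ b ∈ fermatCMType 35 r s (-(r + s)), a * b ∈ fermatCMType 35 r s (-(r + s)) := by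
  decide +kernel

set_option maxHeartbeats 1000000 in
/-- **Level `36`**: NO primitive normalised triple `(r, s, −r−s)` modulo `36` has `H_{r,s,t}` closed under multiplication (kernel, all `(r, s)`).
[cite: BauerCosteItzyksonRuelle1997, §3.4] -/
theorem not_exists_primitive_group_triple_thirtySix :
    ¬∃ r s : ZMod 36, r ≠ 0 ∧ s ≠ 0 ∧ r.val + s.val < 36 ∧ Nat.gcd (Nat.gcd r.val s.val) 36 = 1 ∧
      ∀ a ∈ fermatCMType 36 r s (-(r + s)), ∀ b ∈ fermatCMType 36 r s (-(r + s)), a * b ∈ fermatCMType 36 r s (-(r + s)) := by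
  decide +kernel

set_option maxHeartbeats 1000000 in
/-- **Level `37`**: NO primitive normalised triple `(r, s, −r−s)` modulo `37` has `H_{r,s,t}` closed under multiplication (kernel, all `(r, s)`).
[cite: BauerCosteItzyksonRuelle1997, §3.4] -/
theorem not_exists_primitive_group_triple_thirtySeven :
    ¬∃ r s : ZMod 37, r ≠ 0 ∧ s ≠ 0 ∧ r.val + s.val < 37 ∧ Nat.gcd (Nat.gcd r.val s.val) 37 = 1 ∧
      ∀ a ∈ fermatCMType 37 r s (-(r + s)), ∀ b ∈ fermatCMType 37 r s (-(r + s)), a * b ∈ fermatCMType 37 r s (-(r + s)) := by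
  decide +kernel

set_option maxHeartbeats 1000000 in
/-- **Level `38`**: NO primitive normalised triple `(r, s, −r−s)` modulo `38` has `H_{r,s,t}` closed under multiplication (kernel, all `(r, s)`).
[cite: BauerCosteItzyksonRuelle1997, §3.4] -/
theorem not_exists_primitive_group_triple_thirtyEight :
    ¬∃ r s : ZMod 38, r ≠ 0 ∧ s ≠ 0 ∧ r.val + s.val < 38 ∧ Nat.gcd (Nat.gcd r.val s.val) 38 = 1 ∧
      ∀ a ∈ fermatCMType 38 r s (-(r + s)), ∀ b ∈ fermatCMType 38 r s (-(r + s)), a * b ∈ fermatCMType 38 r s (-(r + s)) := by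
  decide +kernel

end Levels

/-! ## §2 The census `3 ≤ n ≤ 40` -/

section Census

/-- **THE KERNEL CENSUS FOR `3 ≤ n ≤ 40`.**  A primitive normalised triple `(r, s, −r−s)` modulo `n` with `H_{r,s,t}` closed under multiplication exists
iff `n ∈ {3, 4, 6, 7, 8, 12, 15, 16, 18, 20, 21, 22, 24, 30, 39, 40}` — Koblitz's list below `40`, no other level.
[cite: BauerCosteItzyksonRuelle1997, §3.4] [cite: KoblitzRohrlich1978, §2 Remark 2 (the level `39`)] -/
theorem exists_primitive_group_triple_iff_of_le_forty (n : ℕ) [hnz : NeZero n] (h3 : 3 ≤ n) (h40 : n ≤ 40) :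
    (∃ r s : ZMod n, r ≠ 0 ∧ s ≠ 0 ∧ r.val + s.val < n ∧ Nat.gcd (Nat.gcd r.val s.val) n = 1 ∧
      ∀ a ∈ fermatCMType n r s (-(r + s)), ∀ b ∈ fermatCMType n r s (-(r + s)), a * b ∈ fermatCMType n r s (-(r + s))) ↔
    n ∈ ({3, 4, 6, 7, 8, 12, 15, 16, 18, 20, 21, 22, 24, 30, 39, 40} : Finset ℕ) := by
  by_cases h30 : n ≤ 30
  · rw [exists_primitive_group_triple_iff_of_le_thirty n h3 h30]
    simp only [Finset.mem_insert, Finset.mem_singleton]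
    omega
  · have h31 : 31 ≤ n := by omega
    interval_cases n <;> (obtain rfl : hnz = ⟨by decide⟩ := Subsingleton.elim _ _)
    · exact iff_of_false not_exists_primitive_group_triple_thirtyOne (by decide)
    · exact iff_of_false not_exists_primitive_group_triple_thirtyTwo (by decide)
    · exact iff_of_false not_exists_primitive_group_triple_thirtyThree (by decide)
    · exact iff_of_false not_exists_primitive_group_triple_thirtyFour (by decide)
    · exact iff_of_false not_exists_primitive_group_triple_thirtyFive (by decide)
    · exact iff_of_false not_exists_primitive_group_triple_thirtySix (by decide)
    · exact iff_of_false not_exists_primitive_group_triple_thirtySeven (by decide)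
    · exact iff_of_false not_exists_primitive_group_triple_thirtyEight (by decide)
    · exact iff_of_true (exists_primitive_group_triple_of_mem_koblitzList (by decide)) (by decide)
    · exact iff_of_true (exists_primitive_group_triple_of_mem_koblitzList (by decide)) (by decide)

variable {n : ℕ} [NeZero n] {L : Type} [Field L] [NumberField L] [IsCyclotomicExtension {n} ℚ L]

/-- **THE CONVERSE BELOW `40`, ON ABELIAN VARIETIES**: if some realisation of some primitive normalised K–R type at a level `3 ≤ n ≤ 40` is isogenous to a
power of an elliptic curve, then `n ∈ {3,4,6,7,8,12,15,16,18,20,21,22,24,30,39,40}`. [cite: BauerCosteItzyksonRuelle1997, §3.4] [cite: KoblitzRohrlich1978, §1 p. 1184] -/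
theorem mem_koblitzList_of_exists_isIsogeny_pow_elliptic_of_le_forty (h3 : 3 ≤ n) (h40 : n ≤ 40) {r s : ZMod n} (hr : r ≠ 0) (hs : s ≠ 0)
    (hrs : r.val + s.val < n) (hprim : Nat.gcd (Nat.gcd r.val s.val) n = 1)
    {hS : ∀ c : ZMod n, c.val.Coprime n → (c ∈ fermatCMType n r s (-(r + s)) ↔ -c ∉ fermatCMType n r s (-(r + s)))}
    {A : AbelianVariety ℂ} {ι : 𝓞 L →+* End A} {θ : L →+* Module.End ℂ (complexBetti A.X 1)}
    (hA : IsCMTypeRealisation (cmTypeOfResidues (L := L) (fermatCMType n r s (-(r + s))) hS) A ι θ)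
    (hE : ∃ (E P : AbelianVariety ℂ) (h : ℕ) (π : Fin h → (P ⟶ E)) (g : A ⟶ P),
      E.dim = 1 ∧ Nonempty (IsLimit (Fan.mk P π)) ∧ IsIsogeny g) :
    n ∈ ({3, 4, 6, 7, 8, 12, 15, 16, 18, 20, 21, 22, 24, 30, 39, 40} : Finset ℕ) := by
  have hn2 : 2 < n := by omega
  haveI : IsCMField L := IsCyclotomicExtension.Rat.isCMField L (S := {n}) ⟨n, rfl, hn2⟩
  have hcl := (exists_isIsogeny_pow_elliptic_fermat_iff_forall_mul_mem hn2 (one_mem_fermatCMType_of_val_add_lt hr hrs) hA).1 hE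
  exact (exists_primitive_group_triple_iff_of_le_forty n h3 h40).1 ⟨r, s, hr, hs, hrs, hprim, hcl⟩

end Census

end CyclotomicFermatCMType

end Literature.AlgebraicGeometry.ComplexMultiplication
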